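import Literature.Computability.Cryptography.HallgrenClassGroupSamplerCount
import Literature.Computability.Cryptography.HallgrenClassGroupDivisorSums
import HarnessLib

/-!
# Hallgren 2005 / class groups — ideals with a crowded norm are few

Topic `Literature/Computability/Cryptography`; proof companion of `HallgrenClassGroupSamplerCount.lean`
(`#{𝔞 : N𝔞 = n} ≤ τ(n)`) and `HallgrenClassGroupDivisorSums.lean` (`∑_{a ≤ A} τ(a)² ≤ A(1 + log A)³`).
Theorems only.

An ideal sampler that draws `a ≤ Y` uniformly and then one of the `r_K(a) = #{𝔞 : N𝔞 = a}` ideals of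
norm `a` must give up on the `a` with `r_K(a)` above a polylogarithmic cap `R`. The ideals lost this
way are those whose norm is "crowded", and they are few:

* `mul_card_ideals_crowded_le` — `R · #{𝔞 ≠ 0 : N𝔞 ≤ Y, r_K(N𝔞) > R} ≤ ∑_{a ≤ Y} τ(a)²`
  (group by the norm: a crowded norm `a` carries `r_K(a) ≤ τ(a)` ideals and `R < r_K(a) ≤ τ(a)`);
* `card_ideals_crowded_le` — hence `#{…} ≤ Y (1 + log Y)³ / R`.

## References

* H. Davenport, *Multiplicative Number Theory*, 2nd ed., GTM 74 (1980), Ch. 6 (`r(n) ≤ w τ(n)`)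
  [DavenportMNT1980].
* A. M. Childs, W. van Dam, Rev. Mod. Phys. 82 (2010), §5.7 [ChildsVandam2010].
-/

noncomputable section

open Module NumberField Finset

namespace Literature.Computability.Cryptography.Hallgren2005

variable {K : Type*} [Field K] [NumberField K]

/-- **Ideals with a crowded norm are few**: in a quadratic field,
`R · #{𝔞 ≠ 0 : N𝔞 ≤ Y, R < r_K(N𝔞)} ≤ ∑_{a = 1}^{Y} τ(a)²`, where `r_K(a) = #{𝔟 : N𝔟 = a} ≤ τ(a)`
(`card_ideals_absNorm_eq_le_card_divisors`). [cite: DavenportMNT1980, Ch. 6] -/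
theorem mul_card_ideals_crowded_le (h2 : finrank ℚ K = 2) (Y R : ℕ) :
    R * Set.ncard {I : Ideal (𝓞 K) | I ≠ ⊥ ∧ Ideal.absNorm I ≤ Y ∧
        R < Nat.card {J : Ideal (𝓞 K) // Ideal.absNorm J = Ideal.absNorm I}} ≤
      ∑ a ∈ Icc 1 Y, a.divisors.card ^ 2 := by
  classical
  -- the finite set of crowded ideals
  set 𝓘 : Finset (Ideal (𝓞 K)) :=
    (Ideal.finite_setOf_absNorm_le (S := 𝓞 K) Y).toFinset.filter (fun I => I ≠ ⊥ ∧
      R < Nat.card {J : Ideal (𝓞 K) // Ideal.absNorm J = Ideal.absNorm I}) with h𝓘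
  have hmem𝓘 : ∀ {I : Ideal (𝓞 K)}, I ∈ 𝓘 ↔ I ≠ ⊥ ∧ Ideal.absNorm I ≤ Y ∧
      R < Nat.card {J : Ideal (𝓞 K) // Ideal.absNorm J = Ideal.absNorm I} := by
    intro I
    rw [h𝓘, mem_filter, Set.Finite.mem_toFinset, Set.mem_setOf_eq]
    tauto
  have hset : {I : Ideal (𝓞 K) | I ≠ ⊥ ∧ Ideal.absNorm I ≤ Y ∧
      R < Nat.card {J : Ideal (𝓞 K) // Ideal.absNorm J = Ideal.absNorm I}} = ↑𝓘 := by
    ext I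
    rw [Set.mem_setOf_eq, mem_coe, hmem𝓘]
  rw [hset, Set.ncard_coe_finset]
  -- group by the norm
  have hmaps : (𝓘 : Set (Ideal (𝓞 K))).MapsTo (fun I => Ideal.absNorm I) (Icc 1 Y : Finset ℕ) := by
    intro I hI
    obtain ⟨hI0, hIY, -⟩ := hmem𝓘.1 hI
    rw [mem_coe, mem_Icc]
    exact ⟨Nat.pos_of_ne_zero (mt Ideal.absNorm_eq_zero_iff.1 (by simpa using hI0)), hIY⟩
  rw [card_eq_sum_card_fiberwise hmaps, mul_sum]
  refine sum_le_sum fun a ha => ?_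
  have ha0 : a ≠ 0 := by rw [mem_Icc] at ha; omega
  -- the fibre over `a`
  set F := 𝓘.filter (fun I => Ideal.absNorm I = a) with hF
  have hτ : Nat.card {J : Ideal (𝓞 K) // Ideal.absNorm J = a} ≤ a.divisors.card :=
    card_ideals_absNorm_eq_le_card_divisors h2 ha0
  have hfin : {J : Ideal (𝓞 K) | Ideal.absNorm J = a}.Finite :=
    (Ideal.finite_setOf_absNorm_le (S := 𝓞 K) a).subset fun J hJ => le_of_eq hJ
  have hFle : F.card ≤ Nat.card {J : Ideal (𝓞 K) // Ideal.absNorm J = a} := by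
    have h : (↑F : Set (Ideal (𝓞 K))).ncard ≤ ({J : Ideal (𝓞 K) | Ideal.absNorm J = a} : Set _).ncard :=
      Set.ncard_le_ncard (fun I hI => (mem_filter.1 (mem_coe.1 hI)).2) hfin
    rw [Set.ncard_coe_finset, ← Nat.card_coe_set_eq] at h
    exact h
  by_cases hFe : F = ∅
  · rw [hFe, card_empty, mul_zero]
    exact Nat.zero_le _
  · obtain ⟨I, hI⟩ := nonempty_iff_ne_empty.2 hFe
    obtain ⟨hI𝓘, hIa⟩ := mem_filter.1 hI
    obtain ⟨-, -, hR⟩ := hmem𝓘.1 hI𝓘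
    rw [hIa] at hR
    calc R * F.card ≤ a.divisors.card * a.divisors.card :=
          Nat.mul_le_mul (hR.le.trans hτ) (hFle.trans hτ)
      _ = a.divisors.card ^ 2 := (sq _).symm

/-- **`#{𝔞 ≠ 0 : N𝔞 ≤ Y, R < r_K(N𝔞)} ≤ Y (1 + log Y)³ / R`** for `R ≥ 1` in a quadratic field
(`mul_card_ideals_crowded_le` with `sum_card_divisors_sq_le`). [cite: DavenportMNT1980, Ch. 6] -/
theorem card_ideals_crowded_le (h2 : finrank ℚ K = 2) (Y : ℕ) {R : ℕ} (hR : 0 < R) :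
    (Set.ncard {I : Ideal (𝓞 K) | I ≠ ⊥ ∧ Ideal.absNorm I ≤ Y ∧
        R < Nat.card {J : Ideal (𝓞 K) // Ideal.absNorm J = Ideal.absNorm I}} : ℝ) ≤
      Y * (1 + Real.log Y) ^ 3 / R := by
  have h1 := mul_card_ideals_crowded_le (K := K) h2 Y R
  have h2' := sum_card_divisors_sq_le Y
  have hRR : (0 : ℝ) < R := by exact_mod_cast hR
  rw [le_div_iff₀ hRR, mul_comm]
  have h1R : ((R : ℕ) : ℝ) * (Set.ncard {I : Ideal (𝓞 K) | I ≠ ⊥ ∧ Ideal.absNorm I ≤ Y ∧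
      R < Nat.card {J : Ideal (𝓞 K) // Ideal.absNorm J = Ideal.absNorm I}} : ℝ) ≤
      ((∑ a ∈ Icc 1 Y, a.divisors.card ^ 2 : ℕ) : ℝ) := by exact_mod_cast h1
  exact h1R.trans h2'

end Literature.Computability.Cryptography.Hallgren2005

end
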